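import Summits.CriticalPhenomena.Ising3DConformalLimit.Theorems.PrecisionLaplacianDirectCorrelationStableTailSlabModeExpDecayDiagLineHolAux10
import Summits.CriticalPhenomena.Ising3DConformalLimit.Theorems.PrecisionLaplacianDirectCorrelationStableTailSlabModeExpDecayDiagLineHolAux8
import Summits.CriticalPhenomena.Ising3DConformalLimit.Theorems.PrecisionLaplacianDirectCorrelationStableTailSlabModeExpDecayGreenTransfer
import Summits.CriticalPhenomena.Ising3DConformalLimit.Theorems.PrecisionLaplacianDirectCorrelationStableTailPickInversion
import Summits.CriticalPhenomena.Ising3DConformalLimit.Theorems.PrecisionLaplacianDirectCorrelationStableTailDcfStructure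

/-!
# Brick `stub_slabModeExpDecay_auxDiagLineHol` of stub `stub_slabModeExpDecay` (line
# `self-energy-pick-inversion`, crux `PrecisionLaplacian.DirectCorrelationStableTail`, stmt-CriticalPhenomena-4799):
# LINE HOLOMORPHY of the Green symbol function along the six DIAGONAL frames `u = e_i ± e_j`

**Statement** (the lead's interface `lineHolomorphy_SHAPE` with the frame hypothesis restricted to the
diagonal disjunct). Let `G = criticalTwoPoint 3` satisfy `H`, `a = dcf` its direct correlation function,
`A₀` the limit of `(M_{Λ_n})⁻¹(0,0)`, `q = 𝟙_{≠0} a/A₀`, and `g(p) = (1 - ∑_x q(x) cos(p·x))⁻¹` the Green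
symbol function. Then with `c₀ = 1/2`: for all `d, m > 0` there is `B` such that for every diagonal
frame `u`, every base point `p` with `dist(p·u, 2πℤ) ≥ d` whose `u`-line `{p + t u/2}` stays at
sup-distance `≥ m` from `(2πℤ)³`, the function `s ↦ g(p + s u/2)` extends to a holomorphic `F` on the
disc `|z| < d/2` with `‖F‖ ≤ B` there.

**Proof.** By a signed coordinate permutation (file 10; `q` is hyperoctahedrally invariant, file
`…DcfStructure`) and a reciprocal-lattice translation, `u = e₀ + e₁` and `κ = (p₀ - p₁, p₂) ∈ [-π,π]² ∖ {0}`.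
Along the line, `g(p + s u/2) = γ_κ(θ₀ + s/2)`, `θ₀ = (p₀ + p₁)/2`, where the diagonal line function
`γ_κ` (files 3–4) is even, continuous, `2π`-periodic, and — this is the heart — its cosine transforms
are the moments of a finite POSITIVE measure `ν_κ` on `[-1, 1]` (files 5, 6, 9), because the unified
(even AND odd layer) diagonal forms of `G` are the moments of the spectral measures of the symmetric
one-step diagonal transfer matrix (files 7, 8: the odd layers enter through the reflected second point).
Hence `2π γ_κ(θ) = ∫_{[-1,1]} (1 - y²)/(1 - 2y cos θ + y²) dν_κ(y)` (file 1), holomorphic in `θ` off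
`Re θ ∈ πℤ` with `|1 - 2y cos θ + y²| ≥ sin²(Re θ)`; on the disc `|z| < d/2` one has
`|sin(θ₀ + Re z/2)| ≥ sin(d/4)`, and `ν_κ(ℝ) = ∫ γ_κ ≤ 2π C(m)` (file 9), so `B = C(m)/sin²(d/4)`.
-/

noncomputable section

namespace Summit.CriticalPhenomena.Ising3DConformalLimit.Cruxes.DirectCorrelationStableTail.SelfEnergyPickInversion

open MeasureTheory Filter Topology Finset Real Literature.Probability.LatticeModels
open scoped BigOperators
open Summit.CriticalPhenomena.Ising3DConformalLimit.Theorems.EtaBoundsTransfer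
  (limit_equation summable_a a_nonneg a_neg continuous_fourier_q)

/-- **Registered sub-stub `stub_slabModeExpDecay_auxDiagLineHol`** (brick of `stub_slabModeExpDecay` on
stmt-CriticalPhenomena-4799; the lead's `lineHolomorphy_SHAPE` with the frame hypothesis restricted to the
six diagonal frames; `c₀ = 1/2`, `B = C(m)/sin²(d/4)`). See the module docstring. [folklore] -/
theorem stub_slabModeExpDecay_auxDiagLineHol : (∀ A : Finset (Site 3), (Matrix.of fun (p q : ↥A) => criticalTwoPoint 3 (q.1 - p.1)).PosDef ∧ ∀ u v : ↥A, (u ≠ v → (Matrix.of fun (p q : ↥A) => criticalTwoPoint 3 (q.1 - p.1))⁻¹ u v ≤ 0) ∧ 0 ≤ ∑ w, (Matrix.of fun (p q : ↥A) => criticalTwoPoint 3 (q.1 - p.1))⁻¹ u w) → ∀ A₀ : ℝ, Filter.Tendsto (fun n : ℕ => (Matrix.of fun (p q : ↥(box 3 n)) => criticalTwoPoint 3 (q.1 - p.1))⁻¹ ⟨0, zero_mem_box 3 n⟩ ⟨0, zero_mem_box 3 n⟩) Filter.atTop (nhds A₀) → (∀ n : ℕ, (Matrix.of fun (p q : ↥(box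 3 n)) => criticalTwoPoint 3 (q.1 - p.1))⁻¹ ⟨0, zero_mem_box 3 n⟩ ⟨0, zero_mem_box 3 n⟩ ≤ A₀) → 0 < A₀ → ∃ c₀ : ℝ, 0 < c₀ ∧ ∀ (d m : ℝ), 0 < d → 0 < m → ∃ B : ℝ, ∀ u : Site 3, (∃ i j : Fin 3, i ≠ j ∧ (u = Pi.single i 1 + Pi.single j 1 ∨ u = Pi.single i 1 - Pi.single j 1)) → ∀ p : Fin 3 → ℝ, (∀ n : ℤ, d ≤ |(∑ j, p j * (u j : ℝ)) - 2 * Real.pi * n|) → (∀ (t : ℝ) (L : Fin 3 → ℤ), m ≤ ‖(fun j => p j + t * ((u j : ℝ) / ∑ l, ((u l : ℝ)) ^ 2) - 2 * Real.pi * (L j : ℝ))‖) → ∃ F : ℂ → ℂ, DifferentiableOn ℂ F (Metric.ball (0 : ℂ) (c₀ * d)) ∧ (∀ s : ℝ, |s| < c₀ * d → F (s : ℂ) = (((1 - ∑' x : Site 3, (if x = 0 then (0 : ℝ) else (⨅ A : {A : Finset (Site 3) // (0 : Site 3) ∈ A ∧ x ∈ A}, -((Matrix.of fun (p q : ↥A.1)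 => criticalTwoPoint 3 (q.1 - p.1))⁻¹ ⟨0, A.2.1⟩ ⟨x, A.2.2⟩))) / A₀ * Real.cos (∑ j, (p j + s * ((u j : ℝ) / ∑ l, ((u l : ℝ)) ^ 2)) * ((x j : ℤ) : ℝ)))⁻¹ : ℝ) : ℂ)) ∧ (∀ z : ℂ, ‖z‖ < c₀ * d → ‖F z‖ ≤ B) := by
  intro hH A₀ hkA hkle hA0
  classical
  have hπ := Real.pi_pos
  -- ### the walk dictionary (adapted from `stub_slabModeExpDecay_auxGreenTransfer`)
  set M : (A : Finset (Site 3)) → Matrix ↥A ↥A ℝ :=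
    fun A => Matrix.of fun (p q : ↥A) => criticalTwoPoint 3 (q.1 - p.1) with hMdef
  have hM : ∀ A, M A = Matrix.of fun (p q : ↥A) => criticalTwoPoint 3 (q.1 - p.1) := fun A => rfl
  have hSP : ∀ A : Finset (Site 3), (M A).PosDef ∧
      ∀ u v : ↥A, (u ≠ v → (M A)⁻¹ u v ≤ 0) ∧ 0 ≤ ∑ w, (M A)⁻¹ u w := hH
  set kk : ℕ → ℝ := fun n => (M (box 3 n))⁻¹ ⟨0, zero_mem_box 3 n⟩ ⟨0, zero_mem_box 3 n⟩ with hkkdef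
  have hk : ∀ n, kk n = (M (box 3 n))⁻¹ ⟨0, zero_mem_box 3 n⟩ ⟨0, zero_mem_box 3 n⟩ := fun n => rfl
  set tt : ℕ → Site 3 → ℝ := fun n y =>
    if hy : y ∈ box 3 n then -(M (box 3 n))⁻¹ ⟨0, zero_mem_box 3 n⟩ ⟨y, hy⟩ else 0 with httdef
  have ht : ∀ n y (hy : y ∈ box 3 n), tt n y = -(M (box 3 n))⁻¹ ⟨0, zero_mem_box 3 n⟩ ⟨y, hy⟩ :=
    fun n y hy => by simp only [httdef, dif_pos hy]
  set a : Site 3 → ℝ := fun y => ⨅ A : {A : Finset (Site 3) // (0 : Site 3) ∈ A ∧ y ∈ A},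
    -((M A.1)⁻¹ ⟨0, A.2.1⟩ ⟨y, A.2.2⟩) with hadef
  have ha : ∀ y, a y = ⨅ A : {A : Finset (Site 3) // (0 : Site 3) ∈ A ∧ y ∈ A},
      -((M A.1)⁻¹ ⟨0, A.2.1⟩ ⟨y, A.2.2⟩) := fun y => rfl
  have hGto : Tendsto (criticalTwoPoint 3) cofinite (𝓝 0) := criticalTwoPoint_tendsto_zero_cofinite
  have heq : ∀ z, A₀ * criticalTwoPoint 3 z - ∑' y, (if y = 0 then 0 else a y) * criticalTwoPoint 3 (z - y) =
      if z = 0 then 1 else 0 := fun z => limit_equation hM hSP hGto hk ht ha hkA hkle z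
  obtain ⟨hsa, hsale⟩ := summable_a hSP hk ht ha hkle
  have ha0 : ∀ y, y ≠ 0 → 0 ≤ a y := fun y hy => a_nonneg hSP ha hy
  -- hyperoctahedral invariance of `a` (file `…DcfStructure`)
  have haperm : ∀ (σ : Equiv.Perm (Fin 3)) (y : Site 3), a (fun j => y (σ j)) = a y :=
    fun σ y => iInf_neg_inv_entry_perm σ y
  have harefl : ∀ (j : Fin 3) (y : Site 3), a (Function.update y j (-y j)) = a y :=
    fun j y => iInf_neg_inv_entry_reflect j y
  -- the normalised step law and Green function
  set q : Site 3 → ℝ := fun y => (if y = 0 then 0 else a y) / A₀ with hqdef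
  set G' : Site 3 → ℝ := fun z => A₀ * criticalTwoPoint 3 z with hG'def
  have hq0 : ∀ y, 0 ≤ q y := fun y => by
    simp only [hqdef]; split_ifs with hy
    · simp
    · exact div_nonneg (ha0 y hy) hA0.le
  have hqs : Summable q := hsa.div_const A₀
  have hq1 : ∑' y, q y ≤ 1 := by
    simp only [hqdef]; rw [tsum_div_const]; exact (div_le_one hA0).2 hsale
  have hq00 : q 0 = 0 := by simp [hqdef]
  -- invariance of `q` under lattice maps fixing `0`
  have hqmap : ∀ (f : Site 3 → Site 3), (∀ y, f y = 0 ↔ y = 0) → (∀ y, a (f y) = a y) → ∀ y, q (f y) = q y := by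
    intro f hf0 hfa y
    simp only [hqdef, hf0 y, hfa y]
  have hqev : ∀ y, q (-y) = q y := by
    refine hqmap _ (fun y => neg_eq_zero) (fun y => ?_)
    by_cases hy : y = 0
    · simp [hy]
    · exact a_neg hM hSP ht ha hy
  have hqsym : ∀ x : Site 3, q ![x 1, x 0, -(x 2)] = q x := by
    refine hqmap _ (fun y => ⟨fun h => ?_, fun h => by subst h; ext j; fin_cases j <;> simp⟩) (fun y => ?_)
    · have h0 := congrFun h 0; have h1 := congrFun h 1; have h2 := congrFun h 2
      simp at h0 h1 h2; ext j; fin_cases j <;> simp [h0, h1, h2]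
    · have h1 := harefl 2 (fun j => y (Equiv.swap 0 1 j))
      rw [haperm] at h1
      rw [← h1]; congr 1; ext j; fin_cases j <;> simp [Equiv.swap_apply_def]
  have hqsp : ∀ (σ : Equiv.Perm (Fin 3)) (ε : Fin 3 → ℤ), (∀ l, ε l = 1 ∨ ε l = -1) →
      ∀ x : Site 3, q (fun i => ε (σ.symm i) * x (σ.symm i)) = q x := by
    intro σ ε hε
    have hsigns : ∀ (ε' : Fin 3 → ℤ), (∀ l, ε' l = 1 ∨ ε' l = -1) → ∀ y : Site 3, a (fun i => ε' i * y i) = a y := by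
      intro ε' hε' y
      have step : ∀ (j : Fin 3) (y : Site 3), a (fun i => (if i = j then ε' j else 1) * y i) = a y := by
        intro j y
        rcases hε' j with h | h
        · congr 1; ext i; by_cases hi : i = j <;> simp [hi, h]
        · rw [← harefl j y]; congr 1; ext i; by_cases hi : i = j
          · subst hi; simp [h]
          · simp [hi]
      have h0 := step 0 y; have h1 := step 1 (fun i => (if i = 0 then ε' 0 else 1) * y i)
      have h2 := step 2 (fun i => (if i = 1 then ε' 1 else 1) * ((if i = 0 then ε' 0 else 1) * y i))
      rw [h1, h0] at h2
      rw [← h2]; congr 1; ext i; fin_cases i <;> simp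
    refine hqmap _ (fun y => ⟨fun h => ?_, fun h => ?_⟩) (fun y => ?_)
    · ext l
      have := congrFun h (σ l)
      simp only [Equiv.symm_apply_apply, Pi.zero_apply, mul_eq_zero] at this
      rcases this with h1 | h1
      · rcases hε l with h2 | h2 <;> simp [h2] at h1
      · exact h1
    · subst h; ext i; simp
    · rw [hsigns (fun i => ε (σ.symm i)) (fun i => hε _) (fun i => y (σ.symm i)), haperm]
  -- the Green function and the convolution powers
  have hG'eq : ∀ z, G' z = (if z = 0 then 1 else 0) + ∑' y, q y * G' (z - y) := by
    intro z
    have h1 : ∑' y, q y * G' (z - y) = ∑' y, (if y = 0 then 0 else a y) * criticalTwoPoint 3 (z - y) :=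
      tsum_congr fun y => by simp only [hqdef, hG'def]; field_simp
    rw [h1, ← heq z]; simp only [hG'def]; ring
  set P : ℕ → Site 3 → ℝ := fun j => Nat.rec (fun z => if z = 0 then (1 : ℝ) else 0)
    (fun _ Pj z => ∑' y, q y * Pj (z - y)) j with hPdef
  have hP0 : ∀ z, P 0 z = if z = 0 then 1 else 0 := fun z => rfl
  have hPs : ∀ j z, P (j + 1) z = ∑' y, q y * P j (z - y) := fun j z => rfl
  have hGreen : ∀ z, HasSum (fun j => P j z) (G' z) :=
    hasSum_convPow_of_green_equation hq0 hqs hq1 hq00 hP0 hPs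
      (fun z => mul_nonneg hA0.le (criticalTwoPoint_nonneg' z))
      (fun z => by simpa [hG'def] using mul_le_mul_of_nonneg_left (criticalTwoPoint_le_one' (d := 3) z) hA0.le)
      (by simpa [hG'def] using hGto.const_mul A₀) hG'eq
  have hGpos : ∀ m : Fin 3, 0 < G' (Pi.single m 1) := fun m => mul_pos hA0 (criticalTwoPoint_single_pos m)
  have hGev : ∀ x, G' (-x) = G' x := fun x => by simp only [hG'def, criticalTwoPoint_neg]
  have hGsym : ∀ x : Site 3, G' ![x 1, x 0, -(x 2)] = G' x := fun x => by
    simp only [hG'def]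
    rw [show (![x 1, x 0, -(x 2)] : Site 3) = Site.signedPerm (Equiv.swap 0 1) (Function.update 1 2 (-1)) x by
      ext j; fin_cases j <;> simp [Site.signedPerm_apply, Equiv.swap_apply_def]]
    exact congrArg _ (twoPointPlus_signedPerm _ _ _ x)
  -- the unified diagonal moment property of `G'` (file 8)
  have hT : ∀ (s : Finset (Fin 2 → ℤ)) (c : (Fin 2 → ℤ) → ℝ), ∃ ν : Measure ℝ, IsFiniteMeasure ν ∧
      ν (Set.Icc (-1 : ℝ) 1)ᶜ = 0 ∧ ∀ n : ℕ,
        (∑ a ∈ s, ∑ b ∈ s, c a * c b * G' ![(a 0 - b 0) + n, -(a 0 - b 0) + n, a 1 - b 1] = ∫ x, x ^ (2 * n) ∂ν) ∧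
        (∑ a ∈ s, ∑ b ∈ s, c a * c b * G' ![n + 1 - a 0 - b 0, n + a 0 + b 0, -(a 1) - b 1] = ∫ x, x ^ (2 * n + 1) ∂ν) := by
    intro s c
    obtain ⟨ν, hνfin, hν0, hν⟩ := diagUnified_hausdorff s c
    refine ⟨A₀.toNNReal • ν, inferInstance, by rw [Measure.smul_apply, hν0, smul_zero], fun n => ⟨?_, ?_⟩⟩
    · rw [integral_smul_nnreal_measure, ← (hν n).1, NNReal.smul_def, smul_eq_mul, Real.coe_toNNReal _ hA0.le,
        Finset.mul_sum]
      refine Finset.sum_congr rfl fun x _ => ?_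
      rw [Finset.mul_sum]
      exact Finset.sum_congr rfl fun y _ => by simp only [hG'def]; ring
    · rw [integral_smul_nnreal_measure, ← (hν n).2, NNReal.smul_def, smul_eq_mul, Real.coe_toNNReal _ hA0.le,
        Finset.mul_sum]
      refine Finset.sum_congr rfl fun x _ => ?_
      rw [Finset.mul_sum]
      exact Finset.sum_congr rfl fun y _ => by simp only [hG'def]; ring
  -- ### the constants and the abstract statement (file 10)
  refine ⟨1 / 2, by norm_num, fun d m hd hm => ?_⟩
  obtain ⟨C, hC⟩ := exists_green_bound_of_margin hq0 hqs hq1 hP0 hPs hGreen hGpos hm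
  refine ⟨2 * π * C / (2 * π * Real.sin (d / 4) ^ 2), fun u hu p hpd hpm => ?_⟩
  have h := lineHol_diag_of_stepLaw hq0 hqs hq1 hqev hqsym hqsp hP0 hPs hGreen hGpos hGev hGsym hT hd hm hC hu hpd hpm
  simpa only [phase, hqdef, hadef, hMdef] using h

end Summit.CriticalPhenomena.Ising3DConformalLimit.Cruxes.DirectCorrelationStableTail.SelfEnergyPickInversion

end
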